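import Literature.Computability.Cryptography.RegevReductionCVPqProgramsAssembly
import Literature.Computability.Cryptography.RegevReductionCVPLiftPre
import Literature.Computability.Cryptography.RegevSamplerArithFP
import Literature.Computability.Complexity.CodeFPInvFolds
import Literature.Computability.Complexity.CodeFPTableKit
import Literature.Computability.Complexity.CodeFPStrings
import Literature.Computability.Complexity.CodeFPLists
import Literature.Computability.Complexity.FoldBricks
import Literature.Algebra.EuclideanLattices.GapInstanceCodeFP
import Literature.Computability.Cryptography.ShorProofs
import HarnessLib

/-!
# Regev's CVP_q programs, I: parsing the oracle query and the solver's answers (junk-exact decoders)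

HONEST FRAMING. Part of a first formalisation of a KNOWN reduction (Regev 2009, worst-case
GapSVP/SIVP ≤ LWE, classical part). The value is a THEOREM about that reduction (here: plumbing
lemmas — the total decoders used by Regev's `CVP_q` procedure are polynomial-time string functions,
stated in the tree's typed `CodeFP` algebra, and the query string of the procedure is the code of
typed data). It is NOT progress on any open problem and breaks nothing.

## What is proved

Towards `Nonempty (Regev2009.CVPqPrograms …)` (module `RegevReductionCVPqProgramsAssembly`: the two
classical programs around the LWE solver), this file supplies the PARSING layer, junk-exact (the
programs must agree with the specification on EVERY string, including ill-formed solver answers):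
* `splitL` / `restL` / `codeFP_split` — reading `k` self-delimited items off a string and the rest
  (junk-exact, by `k` iterations of `(fstF, sndF)` with a linear length invariant);
* `secretL`, `secretL_eq_ofFn`, `codeFP_secretL` — the list of residues of the tree's total decoder
  `decodeSecret n q` of a solver answer (length check included), as a `CodeFP` program;
* the TYPED VIEW of a `CVP_q` query: `QData`, `qE`, `qOf`, `qE_qOf : qE (qOf I ρ k t w) = queryOf I ρ k t w`
  (header `((I, ρ), k+1, batch)` with the batch as a typed list of integer coordinate vectors, then
  the rational point `t`), and `codeFP_unApp` — re-pairing `x ++ r ↦ ⟨x, r⟩` for inputs that begin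
  with a query code (the block-manufacture input format `(x ++ e_j) ++ c`);
* `reprL`, `reprL_intCoords` — the coordinates of a lattice vector in the ROW basis `zBasis I`
  computed from its standard integer coordinates by Cramer's rule and one exact division
  (`cramerL`, `detZ`), as a `CodeFP` program (`codeFP_reprL`).

## Sources

Regev 2009 (J. ACM 56(6):34; pages from arXiv:2401.03703): Lemma 3.11 p. 18 (the CVP_q procedure is
"efficient"). Arora–Barak 2009 §0.1, §1.3 (codes of tuples and lists; closure of polynomial time under
composition and bounded loops). Micciancio–Goldwasser 2002 Ch. 1 §1.1 (Cramer's rule, integer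
lattices). Goldreich 2001 §3.2.1.
-/

noncomputable section

namespace Literature.Computability.Cryptography

namespace Regev2009

namespace CVPqProg

open _root_.Computability Literature.Computability.Complexity Literature.Computability.Complexity.CodeFP
  Literature.Computability.Complexity.Brick Literature.Algebra.EuclideanLattices Polynomial
  Literature.LinearAlgebra.Matrix Literature.LinearAlgebra.Matrix.Berkowitz IntDetFP SamplerArithFP Matrix Peikert2009

variable {α β γ σ : Type} {eα : α → List Bool} {eβ : β → List Bool} {eσ : σ → List Bool}

/-! ### Strings: pair codes followed by junk, the two projections as typed programs -/

/-- The length of a code, in unary, for any encoder. [cite: AroraBarak2009, §1.3] -/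
theorem codeLenU (e : α → List Bool) : CodeFP e unE (fun a => (e a).length) :=
  of_fn onesFn onesFn_mem_FP fun _ => rfl

/-- A polynomial of the length of a code, in unary. [cite: AroraBarakCC2009, §1.3] -/
theorem codePolyLenU (e : α → List Bool) (Q : Polynomial ℕ) : CodeFP e unE (fun a => Q.eval (e a).length) :=
  of_fn (Plumb.polyFn Q) (Plumb.polyFn_mem_FP Q) fun a => by rw [Plumb.polyFn_apply, unE_eq_ones]


/-! ### Reading `k` items and the rest off a string -/

/-- The first `k` self-delimited items of a string (junk-exact: `fstF` iterated). [folklore] -/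
def splitL : ℕ → List Bool → List (List Bool)
  | 0, _ => []
  | k + 1, v => fstF v :: splitL k (sndF v)

/-- What is left after `k` items (`sndF` iterated). [folklore] -/
def restL : ℕ → List Bool → List Bool
  | 0, v => v
  | k + 1, v => restL k (sndF v)

/-- `|splitL k v| = k`. [folklore] -/
@[simp] theorem length_splitL : ∀ (k : ℕ) (v : List Bool), (splitL k v).length = k
  | 0, _ => rfl
  | k + 1, v => by rw [splitL, List.length_cons, length_splitL]

/-- On a raw list code followed by junk, `splitL` reads the item codes. [folklore] -/
theorem splitL_rawE_append (e : α → List Bool) : ∀ (l : List α) (z : List Bool),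
    splitL l.length (rawE e l ++ z) = l.map e
  | [], _ => rfl
  | a :: l, z => by
    rw [List.length_cons, splitL, rawE_cons, boolPair_append, fstF_boolPair, sndF_boolPair, List.map_cons,
      splitL_rawE_append e l z]

/-- On a raw list code followed by junk, `restL` returns the junk. [folklore] -/
theorem restL_rawE_append (e : α → List Bool) : ∀ (l : List α) (z : List Bool),
    restL l.length (rawE e l ++ z) = z
  | [], _ => rfl
  | a :: l, z => by
    rw [List.length_cons, restL, rawE_cons, boolPair_append, sndF_boolPair, restL_rawE_append e l z]

/-- `restL` past a raw list code with no junk is `ε`. [folklore] -/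
theorem restL_rawE (e : α → List Bool) (l : List α) : restL l.length (rawE e l) = [] := by
  simpa using restL_rawE_append e l []

/-- `splitL` on a raw list code with no junk. [folklore] -/
theorem splitL_rawE (e : α → List Bool) (l : List α) : splitL l.length (rawE e l) = l.map e := by
  simpa using splitL_rawE_append e l []

/-- One step of the reader: move the next item to the accumulator. [folklore] -/
def splitStep (b : List (List Bool) × List Bool) : List (List Bool) × List Bool :=
  (b.1 ++ [fstF b.2], sndF b.2)

/-- `k` reader steps. [folklore] -/
theorem splitStep_iterate : ∀ (k : ℕ) (acc : List (List Bool)) (v : List Bool),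
    splitStep^[k] (acc, v) = (acc ++ splitL k v, restL k v)
  | 0, acc, v => by simp [splitL, restL]
  | k + 1, acc, v => by
    rw [Function.iterate_succ_apply, splitStep, splitStep_iterate k]
    simp [splitL, restL]

/-- **Reading `k` items (unary `k`) and the rest is polynomial-time**, junk-exact.
[cite: AroraBarak2009, §1.3 (bounded loops)] -/
theorem codeFP_split : CodeFP (pairE unE strE) (pairE (rawE strE) strE) (fun p => (splitL p.1 p.2, restL p.1 p.2)) := by
  have hF : CodeFP (pairE (pairE unE strE) (pairE (rawE strE) strE)) (pairE (rawE strE) strE)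
      (fun t => splitStep t.2) :=
    (((rawAppend strE).comp ((snd _ _).fst'.pair ((rawSingleton strE).comp ((of_fn fstF fstF_mem_FP fun _ => rfl : CodeFP strE strE fstF).comp (snd _ _).snd')))).pair
      ((of_fn sndF sndF_mem_FP fun _ => rfl : CodeFP strE strE sndF).comp (snd _ _).snd')).congr fun _ => rfl
  have h := iterateInv (σ := ℕ × List Bool) (eσ := pairE unE strE) (β := List (List Bool) × List Bool)
    (eβ := pairE (rawE strE) strE) (F := fun _ b => splitStep b) (init := fun s => (([] : List (List Bool)), s.2))
    (k := fun s => s.1)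
    (fun s j b => (rawE strE b.1).length + b.2.length ≤ s.2.length + 2 * j)
    hF ((const _ ([] : List (List Bool))).pair (snd _ _)) (fst _ _)
    (fun s => by simp)
    (fun s j b hb => by
      have h2 := length_fstF_sndF_le b.2
      have e3 : (strE (fstF b.2)).length = (fstF b.2).length := rfl
      show (rawE strE (b.1 ++ [fstF b.2])).length + (sndF b.2).length ≤ s.2.length + 2 * (j + 1)
      rw [rawE_append, List.length_append, rawE_cons, rawE_nil, length_boolPair, List.length_nil]
      omega)
    (4 * X + 2)
    (fun s j b hb => by
      have e1 : (pairE unE strE s).length = 2 * s.1 + 2 + s.2.length := by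
        rw [pairE_apply, length_boolPair, length_unE]; rfl
      have e2 : (pairE (rawE strE) strE b).length = 2 * (rawE strE b.1).length + 2 + b.2.length := by
        rw [pairE_apply, length_boolPair]; rfl
      rw [e2, e1]
      simp only [eval_add, eval_mul, eval_ofNat, eval_X]
      omega)
  exact h.congr fun s => by rw [splitStep_iterate, List.nil_append]

/-! ### The residues of a decoded secret -/

/-- **The residue list of the total decoder of a solver answer**: if the unary length header of the
first field reads `n`, the `n` items of its body decoded by `decodeNat` and reduced mod `q`; else
`n` zeros (exactly `decodeSecret`, as a list of residues). [cite: Regev2009, Lemma 3.11 (proof)] -/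
def secretL (n q : ℕ) (w : List Bool) : List ℕ :=
  if (fstF (fstF w)).length = n then (splitL n (sndF (fstF w))).map (fun s => decodeNat s % q)
  else List.replicate n 0

/-- The list decoder of natural numerals never fails and reads `splitL`. [folklore] -/
theorem listBoolDecode_natBool : ∀ (k : ℕ) (v : List Bool),
    listBoolDecode encodingNatBool k v = some ((splitL k v).map decodeNat)
  | 0, _ => rfl
  | k + 1, v => by
    rw [listBoolDecode, listBoolDecode_natBool k]
    rfl

/-- **`secretL` lists the residues of `decodeSecret`.** [folklore] -/
theorem secretL_eq_ofFn (n q : ℕ) [NeZero q] (w : List Bool) :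
    secretL n q w = List.ofFn fun i => (decodeSecret n q w i).val := by
  have hdec : (encodingFinVec encodingNatBool n).decode (boolUnpair w).1 =
      if h : ((splitL (fstF (fstF w)).length (sndF (fstF w))).map decodeNat).length = n then
        some (fun i => (((splitL (fstF (fstF w)).length (sndF (fstF w))).map decodeNat).get (i.cast h.symm)))
      else none := by
    simp only [encodingFinVec, Encoding.listBool, listBoolDecode_natBool, Option.bind_some]
    rfl
  unfold decodeSecret
  rw [hdec]
  by_cases hn : (fstF (fstF w)).length = n
  · have hlen : ((splitL (fstF (fstF w)).length (sndF (fstF w))).map decodeNat).length = n := by simpa using hn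
    rw [dif_pos hlen]
    simp only [secretL, if_pos hn]
    apply List.ext_getElem (by simp)
    intro i h₁ h₂
    simp [List.getElem_ofFn, ZMod.val_natCast, hn]
  · have hlen : ¬ ((splitL (fstF (fstF w)).length (sndF (fstF w))).map decodeNat).length = n := by simpa using hn
    rw [dif_neg hlen]
    simp only [secretL, if_neg hn]
    simp [List.ofFn_const]

/-- **The residue list of a decoded secret is polynomial-time** on `(1ⁿ, (q, w))`.
[cite: AroraBarak2009, §1.3] -/
theorem codeFP_secretL : CodeFP (pairE unE (pairE natE strE)) (rawE natE) (fun p => secretL p.1 p.2.1 p.2.2) := by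
  have hw : CodeFP (pairE unE (pairE natE strE)) strE (fun p => fstF p.2.2) := (of_fn fstF fstF_mem_FP fun _ => rfl : CodeFP strE strE fstF).comp (snd _ _).snd'
  have htest : CodeFP (pairE unE (pairE natE strE)) bitE (fun p => decide ((fstF (fstF p.2.2)).length = p.1)) :=
    (CodeFP.eq unE_injective).comp (((codeLenU strE).comp ((of_fn fstF fstF_mem_FP fun _ => rfl : CodeFP strE strE fstF).comp hw)).pair (fst _ _))
  have hitems : CodeFP (pairE unE (pairE natE strE)) (rawE strE) (fun p => splitL p.1 (sndF (fstF p.2.2))) :=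
    (codeFP_split.comp ((fst _ _).pair ((of_fn sndF sndF_mem_FP fun _ => rfl : CodeFP strE strE sndF).comp hw))).fst'
  have hg : CodeFP (pairE natE strE) natE (fun t => decodeNat t.2 % t.1) :=
    natMod.comp (((of_fn canonF canonF_mem_FP fun w => canonF_eq_encodeNat_decodeNat w : CodeFP strE natE decodeNat).comp (snd _ _)).pair (fst _ _))
  have hthen : CodeFP (pairE unE (pairE natE strE)) (rawE natE)
      (fun p => (splitL p.1 (sndF (fstF p.2.2))).map fun s => decodeNat s % p.2.1) :=
    ((map (σ := ℕ) (eσ := natE) (eα := strE) (g := fun t => decodeNat t.2 % t.1) hg).comp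
      ((snd _ _).fst'.pair hitems)).congr fun _ => rfl
  have helse : CodeFP (pairE unE (pairE natE strE)) (rawE natE) (fun p => List.replicate p.1 (0 : ℕ)) :=
    (replicateOf natE).comp ((const _ (0 : ℕ)).pair (fst _ _))
  refine (htest.ite hthen helse).congr fun p => ?_
  by_cases h : (fstF (fstF p.2.2)).length = p.1 <;> simp [secretL, h]

/-! ### The typed view of a `CVP_q` query -/

/-- **Query header data**: instance with parameter, round counter, and the batch of integer coordinate
vectors `(n, coords)`. [cite: Regev2009, Lemma 3.11 (proof)] -/
abbrev QHdr : Type := GapSVPInstance × ℕ × List (ℕ × List ℤ)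

/-- Its code (the batch items are the tree's integer-vector codes `⟨bin n, list of sign–magnitude⟩`).
[cite: AroraBarak2009, §0.1] -/
abbrev qhE : QHdr → List Bool := pairE GapSVPInstance.encode (pairE unE (rawE (pairE natE (listE smE))))

/-- **Query data**: header, then the rational point `t`. [cite: Regev2009, Lemma 3.11 (proof)] -/
abbrev QData : Type := QHdr × List ℚ

/-- Its code. [cite: AroraBarak2009, §0.1] -/
abbrev qE : QData → List Bool := pairE qhE (listE encodeRat)

/-- The query data of the `CVP_q` procedure on `(I, ρ)`, round `k`, point `t`, batch `w`.
[cite: Regev2009, Lemma 3.11 (proof)] -/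
def qOf (I : LatticeInstance) (ρ : ℚ) (k : ℕ) (t : Fin I.n → ℚ) {P : ℕ} (w : Fin P → I.lattice) : QData :=
  (((I, ρ), k + 1, List.ofFn fun i => (I.n, List.ofFn (I.intCoords (w i)))), List.ofFn t)

/-- The tree's integer-vector code is the typed pair code. [folklore] -/
theorem vecCode_eq (n : ℕ) (v : Fin n → ℤ) : vecCode n v = pairE natE (listE smE) (n, List.ofFn v) := by
  simp [vecCode, encodeIntVec, intVecEncoding, Encoding.sigmaBool, encodingIntVecFin, encodingFinVec, listE_eq,
    smE, pairE]

/-- The tree's batch code is the raw list code of the typed items. [folklore] -/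
theorem encBatch_eq (n P : ℕ) (b : Fin P → Fin n → ℤ) :
    encBatch n P b = rawE (pairE natE (listE smE)) (List.ofFn fun i => (n, List.ofFn (b i))) := by
  rw [encBatch, rawE, List.map_ofFn]
  exact congrArg encList (congrArg List.ofFn (funext fun i => vecCode_eq n (b i)))

/-- **The code of the query data is the query string of the `CVP_q` procedure.**
[cite: Regev2009, Lemma 3.11 (proof)] -/
theorem qE_qOf (I : LatticeInstance) (ρ : ℚ) (k : ℕ) (t : Fin I.n → ℚ) {P : ℕ} (w : Fin P → I.lattice) :
    qE (qOf I ρ k t w) = queryOf I ρ k t w := by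
  rw [queryOf, LiftPre.query_eq_pairE, encBatch_eq]
  rfl

/-- `n ≤ |x|` for the query data of an instance of dimension `n`. [folklore] -/
theorem n_le_length_qE (I : LatticeInstance) (ρ : ℚ) (k : ℕ) (t : Fin I.n → ℚ) {P : ℕ} (w : Fin P → I.lattice) :
    I.n ≤ (qE (qOf I ρ k t w)).length := by
  have h := n_le_length_encode_pair I ρ
  simp only [qE, qhE, qOf, pairE_apply, length_boolPair]
  omega

/-! ### Re-pairing an appended input `x ++ r ↦ ⟨x, r⟩` -/

/-- The appended input format of the block manufacture: a query code followed by raw bits.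
[cite: Regev2009, Lemma 3.11 (proof)] -/
def appE (p : QData × List Bool) : List Bool := qE p.1 ++ p.2

/-- **Re-pairing is polynomial-time**: from `x ++ r` (with `x` a query code) to `⟨x, r⟩`, by reading the
header, the unary length of the point list, its items, and the rest. [cite: AroraBarak2009, §1.3] -/
theorem codeFP_unApp : CodeFP appE (pairE qE strE) _root_.id := by
  have e1 : ∀ p : QData × List Bool, appE p = boolPair (qhE p.1.1) (boolPair (unE p.1.2.length) (rawE encodeRat p.1.2 ++ p.2)) := by
    intro p
    simp only [appE, pairE_apply, listE, boolPair_append]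
  have hh : CodeFP appE qhE (fun p => p.1.1) := of_fn fstF fstF_mem_FP fun p => by rw [e1, fstF_boolPair]
  have hn : CodeFP appE unE (fun p => p.1.2.length) :=
    of_fn (fstF ∘ sndF) (comp_mem_FP fstF_mem_FP sndF_mem_FP) fun p => by
      rw [e1, Function.comp_apply, sndF_boolPair, fstF_boolPair]
  have hz : CodeFP appE strE (fun p => rawE encodeRat p.1.2 ++ p.2) :=
    of_fn (sndF ∘ sndF) (comp_mem_FP sndF_mem_FP sndF_mem_FP) fun p => by
      rw [e1, Function.comp_apply, sndF_boolPair, sndF_boolPair]; rfl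
  have hsplit : CodeFP appE (pairE (rawE strE) strE) (fun p => (p.1.2.map encodeRat, p.2)) :=
    (codeFP_split.comp (hn.pair hz)).congr fun p => by
      simp only [splitL_rawE_append, restL_rawE_append]
  have hitems : CodeFP appE (listE encodeRat) (fun p => p.1.2) :=
    ((listOfRaw encodeRat).comp (hsplit.fst'.recodeOut (eγ := rawE encodeRat) (g' := fun p => p.1.2) fun p => by
      simp [rawE, List.map_map])).congr fun _ => rfl
  exact ((hh.pair hitems).pair hsplit.snd').congr fun p => by rcases p with ⟨⟨h, ts⟩, r⟩; rfl

/-! ### Coordinates in the row basis (Cramer's rule, one exact division) -/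

/-- **Row-basis coordinates from standard coordinates**: `(Bᵀ)⁻¹ u = adj(Bᵀ) u / det B`, computed as
`cramerL (rows B) u` divided entrywise by `detZ (rows B)`. [cite: MicciancioGoldwasser2002, Ch. 1 §1.1] -/
def reprL (rowsB : List (List ℤ)) (u : List ℤ) : List ℤ := (cramerL rowsB u).map (· / detZ rowsB)

/-- `reprL` on codes. [cite: AroraBarak2009, §1.3] -/
theorem codeFP_reprL : CodeFP (pairE (rawE (rawE intE)) (rawE intE)) (rawE intE) (fun p => reprL p.1 p.2) := by
  have hd : CodeFP (pairE (rawE (rawE intE)) (rawE intE)) intE (fun p => detZ p.1) := detZ_codeFP.comp (fst _ _)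
  exact (codeFP_divL.comp (codeFP_cramerL.pair hd)).congr fun _ => rfl

/-- The standard integer coordinates of a lattice vector are `Bᵀ` times its row-basis coordinates.
[cite: MicciancioGoldwasser2002, Ch. 1 §1.1] -/
theorem intCoords_eq_mulVec (I : LatticeInstance) [IsZLattice ℝ I.lattice] (v : I.lattice) :
    I.intCoords v = I.basisᵀ *ᵥ fun i => (zBasis I).repr v i := by
  have h : intVecToEuclidean I.n (I.intCoords v) = intVecToEuclidean I.n (I.basisᵀ *ᵥ fun i => (zBasis I).repr v i) := by
    rw [LatticeInstance.intVecToEuclidean_intCoords, mulVec_transpose, ← ofCoeffs_repr I v]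
    rfl
  funext j
  have hj := congrFun (congrArg (fun x : EuclideanSpace ℝ (Fin I.n) => (x : Fin I.n → ℝ)) h) j
  simp only [intVecToEuclidean_apply] at hj
  exact_mod_cast hj

/-- **`reprL` computes the row-basis coordinates** of a vector of a nonsingular integer lattice from its
standard integer coordinates. [cite: MicciancioGoldwasser2002, Ch. 1 §1.1 (Cramer)] -/
theorem reprL_intCoords (I : LatticeInstance) [IsZLattice ℝ I.lattice] (v : I.lattice) :
    reprL (GapCodes.matRows I.basis) (List.ofFn (I.intCoords v)) = List.ofFn fun i => (zBasis I).repr v i := by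
  have hB : I.basis.det ≠ 0 := isNonsingular_of_isZLattice I
  have hrows : GapCodes.matRows I.basis = rows I.basisᵀᵀ := by rw [transpose_transpose]; rfl
  rw [reprL, hrows, intCoords_eq_mulVec, cramerL_rows, detZ_rows, transpose_transpose, List.map_ofFn]
  congr 1
  funext i
  simp only [Function.comp_apply]
  rw [cramer_eq_adjugate_mulVec, mulVec_mulVec, adjugate_mul, smul_mulVec, one_mulVec, det_transpose,
    Pi.smul_apply, smul_eq_mul, Int.mul_ediv_cancel_left _ hB]

/-- The row list of the basis read off the instance code. [cite: AroraBarak2009, §1.3] -/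
theorem codeFP_matRows : CodeFP GapSVPInstance.encode (rawE (rawE intE)) (fun p => GapCodes.matRows p.1.basis) :=
  GapCodes.svpRows_codeFP.congr GapCodes.svpRows_eq_matRows

end CVPqProg

end Regev2009

end Literature.Computability.Cryptography
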